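import Summits.KontsevichZagierPeriods.KontsevichZagierPeriods.Theorems.HurwitzMicroSectorsNormalFormPrincipleEvenZetaLayer
import Summits.KontsevichZagierPeriods.KontsevichZagierPeriods.Theorems.HurwitzMicroSectorsNormalFormPrincipleLevelTwoEvenReduction
import Summits.KontsevichZagierPeriods.KontsevichZagierPeriods.Theorems.HurwitzMicroSectorsNormalFormPrincipleLevelKResonant
import Summits.KontsevichZagierPeriods.KontsevichZagierPeriods.Theorems.HurwitzMicroSectorsNormalFormPrincipleM2CycloLogLayer
import Summits.KontsevichZagierPeriods.KontsevichZagierPeriods.Theorems.HurwitzMicroSectorsNormalFormPrincipleM2AffineBoxes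

/-!
# `NormalFormPrinciple` (stmt-KontsevichZagierPeriods-3869), line `SketchIdeator1` — leaf `stub_boxRigidity`:
# THE `ℚ̄[π²]` WORLD: one kernel theorem for all π-power layers of this line, unconditionally

Capstone of the `π` side of the line. The weight-two layers with real-algebraic coefficients — level
one `[(0,1)², P/(1−xy)]` (`…AlgLevelOneReduction`), even level two `[(0,1)², P/(1−x²y²)]`
(`…LevelTwoEvenReduction`), the resonant boxes `c x^a y^b/(1 − x^{k₁}y^{k₂})` with `2θ ∈ ℤ`
(`…LevelKResonant`), seat c7's rational level one `[(0,1)², P/(1−xy)]`, `P ∈ ℚ[x,y]`, with the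
polynomial boxes `[(0,1)^m, p]`, the cyclotomic log monomials of `…M2CycloLogLayer` and the
affine-unfoldable boxes `[(0,1)², k/(A(x)+xy)]` of `…M2AffineBoxes` (e.g. `12/(1+x²+xy)`, `3/(1+x+x²+xy)`)
— all reduce to
a `(β, q)` normal form `[(0,1)², β/(1−xy)] + [pt, q]`, which is the
`k = 0` instance of the even-zeta normal form `[pt, q] + Σ_k [(0,1)^{2k}, β_k/(1 − Πxₗ)]` of
`…EvenZetaReduction` (`nf_of_weightTwo_normalForm`). Hence ONE closure induction and ONE rigidity
statement (Euler `ζ(2k) ∈ ℚ^×π^{2k}` + Lindemann, `even_zeta_rigid`) give Conjecture 1 in kernel form on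
the subgroup generated by ALL of them together with the diagonal even boxes of all even weights, the
constant boxes and the algebraic points (`piWorld_mem_relations_of_eval_eq_zero_of_mem_closure`):
the calculus realises every `ℤ`-relation among these periods that holds in `ℝ`; their values span the
`ℚ̄`-vector space `ℚ̄·1 + ℚ̄·π² + ℚ̄·π⁴ + ⋯`. The complementary "Baker world" (logarithms and `π`) is
`…WeightNLayer`/`…WeightNAlgLayer`/the Stokes layer; joining the two worlds would need the
algebraic independence of `π` and logarithms of algebraic numbers (open).
[cite: KontsevichZagier2001, §1.2 Conjecture 1] No new definitions.
-/

noncomputable section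

open MeasureTheory Set
open Literature.NumberTheory.Transcendental Literature.NumberTheory.Transcendental.KZ
open Literature.ModelTheory.ExponentialFields (IsSemialgebraic)

namespace Summit.KontsevichZagierPeriods.HurwitzMicroSectors.NormalFormPrinciple.PiBox.EvenZeta

open Summit.KontsevichZagierPeriods.HurwitzMicroSectors.NormalFormPrinciple.PiBox.Dlog
  (pt_add_mem_relations pt_zero_mem_relations pt_congr_mem_relations exists_ptCarrierA)
open Summit.KontsevichZagierPeriods.HurwitzMicroSectors.NormalFormPrinciple.PiBox.Dlog.K22 (mk_eq_mk_of_sub_mem)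

/-! ## The `ℚ̄[π²]` world: even zeta values together with the weight-two π² layers -/

open Summit.KontsevichZagierPeriods.HurwitzMicroSectors.NormalFormPrinciple.PiBox.AlgLevelOne
  (alg_levelOne_normalForm isAlgebraic_div_nat)
open Summit.KontsevichZagierPeriods.HurwitzMicroSectors.NormalFormPrinciple.PiBox.AlgLevelTwo
  (levelTwo_normalForm_even)
open Summit.KontsevichZagierPeriods.HurwitzMicroSectors.NormalFormPrinciple.PiBox.LevelK
  (resonantInt_sub_levelOne resonantHalf_sub_levelTwo levelOneMonomial_mem evenMonomial_mem)
open Summit.KontsevichZagierPeriods.HurwitzMicroSectors.NormalFormPrinciple.PiBox.M2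
  (exists_mem_levelOneClosure_of_mem_cycloClosure affineBox_reduce)

/-- **A weight-two `(β, q)` normal form is an even-zeta normal form** with the single carrier `k = 0`:
if `x − [(0,1)², β/(1−xy)] − [pt, q] ∈ relations` for all such carriers, then `NF(x)`.
[cite: KontsevichZagier2001, §1.2] -/
theorem nf_of_weightTwo_normalForm (Zf : ℝ → IntegralRep 0) (hZf : ∀ r, IsAlgebraic ℚ r → (Zf r).domain = Set.univ ∧ ((Zf r).integrand = fun _ => r))
    (Bf : (k : ℕ) → ℝ → IntegralRep (2 * (k + 1)))
    (hBf : ∀ k c, IsAlgebraic ℚ c → (Bf k c).domain = {x | ∀ i, x i ∈ Set.Ioo (0:ℝ) 1} ∧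
      ((Bf k c).integrand = fun x => c * (∏ l, x l) ^ 0 / (1 - ∏ l, x l))) {x : FormalRep} {β q : ℝ} (hβ : IsAlgebraic ℚ β) (hq : IsAlgebraic ℚ q)
    (h : ∀ (B : IntegralRep 2) (Z : IntegralRep 0), B.domain = {x | ∀ i, x i ∈ Set.Ioo (0:ℝ) 1} →
      EqOn B.integrand (fun x => β / (1 - x 0 * x 1)) B.domain →
      Z.domain = Set.univ → (Z.integrand = fun _ => q) → x - of B - of Z ∈ relations) :
    ∃ (q : ℝ) (T : Finset ℕ) (β : ℕ → ℝ), IsAlgebraic ℚ q ∧ (∀ k ∈ T, IsAlgebraic ℚ (β k)) ∧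
      QuotientAddGroup.mk' relations x =
        QuotientAddGroup.mk' relations (of (Zf q)) + ∑ k ∈ T, QuotientAddGroup.mk' relations (of (Bf k (β k))) := by
  refine ⟨q, {0}, fun _ => β, hq, fun _ _ => hβ, ?_⟩
  rw [Finset.sum_singleton, ← map_add]
  refine mk_eq_mk_of_sub_mem ?_
  have e : x - (of (Zf q) + of (Bf 0 β)) = x - of (Bf 0 β) - of (Zf q) := by abel
  rw [e]
  exact h (Bf 0 β) (Zf q) (hBf 0 β hβ).1 (fun y hy => by rw [(hBf 0 β hβ).2]; simp [Fin.prod_univ_two])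
    (hZf q hq).1 (hZf q hq).2

/-- **Normal forms on the whole `ℚ̄[π²]` world**: the subgroup generated by the diagonal even boxes of
all even weights, the constant boxes, the algebraic points, the algebraic level-one boxes
`[(0,1)², P/(1−xy)]`, the even level-two boxes `[(0,1)², P/(1−x²y²)]` and the resonant weight-two boxes
with `2θ ∈ ℤ`. [cite: KontsevichZagier2001, §1.2] -/
theorem piWorld_exists_nf_of_mem_closure (Zf : ℝ → IntegralRep 0) (hZf : ∀ r, IsAlgebraic ℚ r → (Zf r).domain = Set.univ ∧ ((Zf r).integrand = fun _ => r))
    (Bf : (k : ℕ) → ℝ → IntegralRep (2 * (k + 1)))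
    (hBf : ∀ k c, IsAlgebraic ℚ c → (Bf k c).domain = {x | ∀ i, x i ∈ Set.Ioo (0:ℝ) 1} ∧
      ((Bf k c).integrand = fun x => c * (∏ l, x l) ^ 0 / (1 - ∏ l, x l))) {x : FormalRep}
    (hx : x ∈ AddSubgroup.closure
      ((({y : FormalRep | ∃ (k : ℕ) (S : Finset ℕ) (coef : ℕ → ℝ) (N : IntegralRep (2 * (k + 1))),
          (∀ i ∈ S, IsAlgebraic ℚ (coef i)) ∧ N.domain = {x | ∀ i, x i ∈ Set.Ioo (0:ℝ) 1} ∧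
          EqOn N.integrand (fun x => (∑ i ∈ S, coef i * (∏ l, x l) ^ i) / (1 - ∏ l, x l)) N.domain ∧
          y = of N} ∪
       {y : FormalRep | ∃ (w : ℕ) (c : ℝ) (N : IntegralRep w), IsAlgebraic ℚ c ∧
          N.domain = {x | ∀ i, x i ∈ Set.Ioo (0:ℝ) 1} ∧ EqOn N.integrand (fun _ => c) N.domain ∧ y = of N} ∪
       {y : FormalRep | ∃ (r : ℝ) (Z : IntegralRep 0), IsAlgebraic ℚ r ∧ Z.domain = Set.univ ∧
          (Z.integrand = fun _ => r) ∧ y = of Z} ∪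
       {y : FormalRep | ∃ (P : MvPolynomial (Fin 2) ℝ) (N : IntegralRep 2),
          (∀ s, IsAlgebraic ℚ (P.coeff s)) ∧ N.domain = {x | ∀ i, x i ∈ Set.Ioo (0:ℝ) 1} ∧
          EqOn N.integrand (fun x => MvPolynomial.eval x P / (1 - x 0 * x 1)) N.domain ∧ y = of N} ∪
       {y : FormalRep | ∃ (P : MvPolynomial (Fin 2) ℝ) (N : IntegralRep 2),
          (∀ s, IsAlgebraic ℚ (P.coeff s)) ∧ (∀ s ∈ P.support, Even (s 0 + s 1)) ∧
          N.domain = {x | ∀ i, x i ∈ Set.Ioo (0:ℝ) 1} ∧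
          EqOn N.integrand (fun x => MvPolynomial.eval x P / (1 - x 0 ^ 2 * x 1 ^ 2)) N.domain ∧
          y = of N} ∪
       {y : FormalRep | ∃ (k₁ k₂ j a b : ℕ) (c : ℝ) (N : IntegralRep 2), 0 < k₁ ∧ 0 < k₂ ∧ 0 < j ∧
          a + 1 = j * k₁ ∧ b + 1 = j * k₂ ∧ IsAlgebraic ℚ c ∧
          N.domain = {x | ∀ i, x i ∈ Set.Ioo (0:ℝ) 1} ∧
          EqOn N.integrand (fun x => c * (x 0 ^ a * x 1 ^ b) / (1 - x 0 ^ k₁ * x 1 ^ k₂)) N.domain ∧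
          y = of N} ∪
       {y : FormalRep | ∃ (k₁' k₂' j a b : ℕ) (c : ℝ) (N : IntegralRep 2), 0 < k₁' ∧ 0 < k₂' ∧
          a + 1 = (2 * j + 1) * k₁' ∧ b + 1 = (2 * j + 1) * k₂' ∧ IsAlgebraic ℚ c ∧
          N.domain = {x | ∀ i, x i ∈ Set.Ioo (0:ℝ) 1} ∧
          EqOn N.integrand (fun x => c * (x 0 ^ a * x 1 ^ b) / (1 - x 0 ^ (2 * k₁') * x 1 ^ (2 * k₂')))
            N.domain ∧ y = of N}) ∪
       ({y : FormalRep | ∃ (P : MvPolynomial (Fin 2) ℚ) (N : IntegralRep 2),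
          N.domain = {x | ∀ i, x i ∈ Set.Ioo (0:ℝ) 1} ∧
          EqOn N.integrand (fun x => (MvPolynomial.aeval x P : ℝ) / (1 - x 0 * x 1)) N.domain ∧
          y = of N} ∪
       {y : FormalRep | ∃ (m : ℕ) (p : MvPolynomial (Fin m) ℚ) (N : IntegralRep m),
          N.domain = {x | ∀ i, x i ∈ Set.Ioo (0:ℝ) 1} ∧
          EqOn N.integrand (fun x => (MvPolynomial.aeval x p : ℝ)) N.domain ∧ y = of N}) ∪
       {y : FormalRep | ∃ (c : ℚ) (n : ℕ) (a b a' b' : ℕ → ℕ) (R : IntegralRep 2),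
          (∀ t ∈ Set.Ioo (0:ℝ) 1,
            ∏ d ∈ Finset.range n, (∑ i ∈ Finset.range (d + 1), t ^ i) ^ (a' d) *
              (1 / (1 - t ^ (d + 1))) ^ (b' d) ≤
            ∏ d ∈ Finset.range n, (∑ i ∈ Finset.range (d + 1), t ^ i) ^ (a d) *
              (1 / (1 - t ^ (d + 1))) ^ (b d)) ∧
          R.domain = KZlog.band {y : Fin 1 → ℝ | 0 < y 0 ∧ y 0 < 1} (fun _ => (1:ℝ))
            (fun y => (∏ d ∈ Finset.range n,
              (∑ i ∈ Finset.range (d + 1), y 0 ^ i) ^ (a d) * (1 / (1 - y 0 ^ (d + 1))) ^ (b d)) /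
              (∏ d ∈ Finset.range n,
              (∑ i ∈ Finset.range (d + 1), y 0 ^ i) ^ (a' d) * (1 / (1 - y 0 ^ (d + 1))) ^ (b' d))) ∧
          EqOn R.integrand (fun z => ((c : ℝ) / z 0) / z 1) R.domain ∧ y = of R}) ∪
       {y : FormalRep | ∃ (A : ℝ → ℝ) (n : ℕ) (a b a' b' : ℕ → ℕ) (k : ℕ) (N : IntegralRep 2),
          IsSemialgebraicFunOn ℚ {y : Fin 1 → ℝ | 0 < y 0 ∧ y 0 < 1} (fun y => A (y 0)) ∧
          DifferentiableOn ℝ (fun y : Fin 1 → ℝ => A (y 0)) {y : Fin 1 → ℝ | 0 < y 0 ∧ y 0 < 1} ∧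
          (∀ x ∈ Set.Ioo (0:ℝ) 1, 0 < A x) ∧
          (∃ T : IntegralRep 2,
            T.domain = KZlog.band {y : Fin 1 → ℝ | 0 < y 0 ∧ y 0 < 1} (fun _ => (0:ℝ)) (fun _ => (1:ℝ)) ∧
            T.integrand = fun z => 1 / (A (z 0) + z 0 * z 1)) ∧
          (∀ t ∈ Set.Ioo (0:ℝ) 1, (A t + t) / A t =
            (∏ d ∈ Finset.range n, (∑ i ∈ Finset.range (d + 1), t ^ i) ^ (a d) *
              (1 / (1 - t ^ (d + 1))) ^ (b d)) /
            (∏ d ∈ Finset.range n, (∑ i ∈ Finset.range (d + 1), t ^ i) ^ (a' d) *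
              (1 / (1 - t ^ (d + 1))) ^ (b' d))) ∧
          N.domain = {x | ∀ i, x i ∈ Set.Ioo (0:ℝ) 1} ∧
          EqOn N.integrand (fun z => (k : ℝ) / (A (z 0) + z 0 * z 1)) N.domain ∧ y = of N})) :
    ∃ (q : ℝ) (T : Finset ℕ) (β : ℕ → ℝ), IsAlgebraic ℚ q ∧ (∀ k ∈ T, IsAlgebraic ℚ (β k)) ∧
      QuotientAddGroup.mk' relations x =
        QuotientAddGroup.mk' relations (of (Zf q)) + ∑ k ∈ T, QuotientAddGroup.mk' relations (of (Bf k (β k))) := by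
  -- the two weight-two normal forms, usable as functions
  have hL1 : ∀ (P : MvPolynomial (Fin 2) ℝ) (N : IntegralRep 2), (∀ s, IsAlgebraic ℚ (P.coeff s)) →
      N.domain = {x | ∀ i, x i ∈ Set.Ioo (0:ℝ) 1} →
      EqOn N.integrand (fun x => MvPolynomial.eval x P / (1 - x 0 * x 1)) N.domain →
      ∃ (q : ℝ) (T : Finset ℕ) (β : ℕ → ℝ), IsAlgebraic ℚ q ∧ (∀ k ∈ T, IsAlgebraic ℚ (β k)) ∧
      QuotientAddGroup.mk' relations (of N) =
        QuotientAddGroup.mk' relations (of (Zf q)) + ∑ k ∈ T, QuotientAddGroup.mk' relations (of (Bf k (β k))) := fun P N hP hNd hNi => by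
    obtain ⟨β, q, hβ, hq, h⟩ := alg_levelOne_normalForm P hP N hNd hNi
    exact nf_of_weightTwo_normalForm Zf hZf Bf hBf hβ hq h
  have hL2 : ∀ (P : MvPolynomial (Fin 2) ℝ) (N : IntegralRep 2), (∀ s, IsAlgebraic ℚ (P.coeff s)) →
      (∀ s ∈ P.support, Even (s 0 + s 1)) → N.domain = {x | ∀ i, x i ∈ Set.Ioo (0:ℝ) 1} →
      EqOn N.integrand (fun x => MvPolynomial.eval x P / (1 - x 0 ^ 2 * x 1 ^ 2)) N.domain →
      ∃ (q : ℝ) (T : Finset ℕ) (β : ℕ → ℝ), IsAlgebraic ℚ q ∧ (∀ k ∈ T, IsAlgebraic ℚ (β k)) ∧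
      QuotientAddGroup.mk' relations (of N) =
        QuotientAddGroup.mk' relations (of (Zf q)) + ∑ k ∈ T, QuotientAddGroup.mk' relations (of (Bf k (β k))) := fun P N hP hev hNd hNi => by
    obtain ⟨β, q, hβ, hq, h⟩ := levelTwo_normalForm_even P hP hev N hNd hNi
    exact nf_of_weightTwo_normalForm Zf hZf Bf hBf hβ hq h
  induction hx using AddSubgroup.closure_induction with
  | mem y hy =>
    rcases hy with ((hy | hy) | hy) | hy
    rotate_left
    · -- seat c7's rational level-one boxes and polynomial boxes (any dimension)
      obtain ⟨β, q, h⟩ := LevelOne.exists_normalForm_of_mem_closure (AddSubgroup.subset_closure hy)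
      exact nf_of_weightTwo_normalForm Zf hZf Bf hBf (isAlgebraic_algebraMap β) (isAlgebraic_algebraMap q) h
    · -- the cyclotomic log monomials: congruent to an element of c7's subgroup
      obtain ⟨x', hx', e⟩ := exists_mem_levelOneClosure_of_mem_cycloClosure
        (AddSubgroup.subset_closure (Or.inl hy))
      obtain ⟨β, q, h⟩ := LevelOne.exists_normalForm_of_mem_closure hx'
      obtain ⟨q', T, β', hq', hβ', h'⟩ := nf_of_weightTwo_normalForm Zf hZf Bf hBf (isAlgebraic_algebraMap β)
        (isAlgebraic_algebraMap q) h
      exact ⟨q', T, β', hq', hβ', (mk_eq_mk_of_sub_mem e).trans h'⟩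
    · -- the affine-unfoldable boxes `[(0,1)², k/(A(x)+xy)]`: related to a rational level-one box
      obtain ⟨A, n, a, b, a', b', k, N, hA, hAd, hA0, hT, hfac, hNd, hNi, rfl⟩ := hy
      set q₀ : ℚ := (k : ℚ) * ((∑ d ∈ Finset.range n,
        ((a d : ℚ) * (1 - 1 / (d + 1)) + (b d : ℚ) / (d + 1)) - ∑ d ∈ Finset.range n,
        ((a' d : ℚ) * (1 - 1 / (d + 1)) + (b' d : ℚ) / (d + 1)))) with hq₀
      obtain ⟨B, hBd, hBi⟩ := LevelOne.exists_zetaTwoRep q₀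
      have e := affineBox_reduce A hA hAd hA0 hT n a b a' b' hfac k N B hNd hNi hBd hBi
      have hB : of B ∈ AddSubgroup.closure
          ({y : FormalRep | ∃ (P : MvPolynomial (Fin 2) ℚ) (N : IntegralRep 2),
              N.domain = {x | ∀ i, x i ∈ Set.Ioo (0:ℝ) 1} ∧
              EqOn N.integrand (fun x => (MvPolynomial.aeval x P : ℝ) / (1 - x 0 * x 1)) N.domain ∧
              y = of N} ∪
           {y : FormalRep | ∃ (m : ℕ) (p : MvPolynomial (Fin m) ℚ) (N : IntegralRep m),
              N.domain = {x | ∀ i, x i ∈ Set.Ioo (0:ℝ) 1} ∧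
              EqOn N.integrand (fun x => (MvPolynomial.aeval x p : ℝ)) N.domain ∧ y = of N}) :=
        AddSubgroup.subset_closure (Or.inl ⟨MvPolynomial.C q₀, B, hBd, fun x hx => by
          rw [hBi hx]; simp only [MvPolynomial.aeval_C, eq_ratCast], rfl⟩)
      obtain ⟨β, q, h⟩ := LevelOne.exists_normalForm_of_mem_closure hB
      obtain ⟨q', T, β', hq', hβ', h'⟩ := nf_of_weightTwo_normalForm Zf hZf Bf hBf (isAlgebraic_algebraMap β)
        (isAlgebraic_algebraMap q) h
      exact ⟨q', T, β', hq', hβ', (mk_eq_mk_of_sub_mem e).trans h'⟩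
    rcases hy with (((hy | hy) | hy) | hy) | hy
    · -- the even-zeta generators (three kinds)
      exact exists_nf_of_mem_closure Zf hZf Bf hBf (AddSubgroup.subset_closure hy)
    · obtain ⟨P, N, hP, hNd, hNi, rfl⟩ := hy
      exact hL1 P N hP hNd hNi
    · obtain ⟨P, N, hP, hev, hNd, hNi, rfl⟩ := hy
      exact hL2 P N hP hev hNd hNi
    · obtain ⟨k₁, k₂, j, a, b, c, N, hk₁, hk₂, hj, ha, hb, hc, hNd, hNi, rfl⟩ := hy
      obtain ⟨M, hMd, hMi, e⟩ := resonantInt_sub_levelOne k₁ k₂ hk₁ hk₂ j hj a b ha hb c hc N hNd hNi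
      obtain ⟨P, N', hP, hN'd, hN'i, hMN'⟩ := levelOneMonomial_mem _ (isAlgebraic_div_nat hc _) (j - 1) (j - 1)
        M hMd (fun y _ => by rw [hMi])
      obtain ⟨q, T, β, hq, hβ, h⟩ := hL1 P N' hP hN'd hN'i
      exact ⟨q, T, β, hq, hβ, (mk_eq_mk_of_sub_mem e).trans (hMN' ▸ h)⟩
    · obtain ⟨k₁', k₂', j, a, b, c, N, hk₁, hk₂, ha, hb, hc, hNd, hNi, rfl⟩ := hy
      obtain ⟨M, hMd, hMi, e⟩ := resonantHalf_sub_levelTwo k₁' k₂' hk₁ hk₂ j a b ha hb c hc N hNd hNi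
      obtain ⟨P, N', hP, hev, hN'd, hN'i, hMN'⟩ := evenMonomial_mem _ (isAlgebraic_div_nat hc _) (2 * j) (2 * j)
        ⟨2 * j, rfl⟩ M hMd (fun y _ => by rw [hMi])
      obtain ⟨q, T, β, hq, hβ, h⟩ := hL2 P N' hP hev hN'd hN'i
      exact ⟨q, T, β, hq, hβ, (mk_eq_mk_of_sub_mem e).trans (hMN' ▸ h)⟩
  | zero =>
    refine ⟨0, ∅, fun _ => 0, isAlgebraic_zero, fun _ h => (Finset.notMem_empty _ h).elim, ?_⟩
    rw [Finset.sum_empty, add_zero, ptCarrier_zero Zf hZf, map_zero]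
  | add y z _ _ ihy ihz => exact nf_add Zf hZf Bf hBf ihy ihz
  | neg y _ ihy => exact nf_neg Zf hZf Bf hBf ihy

/-- **Conjecture 1 of Kontsevich–Zagier, kernel form, for THE WHOLE `ℚ̄[π²]` WORLD OF THIS LINE** —
unconditionally: formal `ℤ`-combinations of diagonal level-one boxes of ALL EVEN WEIGHTS
(`ℚ̄`-polynomial numerators), constant boxes, algebraic points, algebraic level-one boxes
`[(0,1)², P/(1−xy)]`, even level-two boxes `[(0,1)², P/(1−x²y²)]` (incl. `1/(1+xy)`) and resonant
weight-two boxes `c x^a y^b/(1 − x^{k₁}y^{k₂})` with `2θ ∈ ℤ`, of value `0`, are relations. One normal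
form `[pt, q] + Σ_k [(0,1)^{2k}, β_k/(1 − Πxₗ)]` for all of them; rigidity by Euler and Lindemann
(`π²` transcendental). Values: the `ℚ̄`-span of `1, π², π⁴, …` realised by these boxes.
[cite: KontsevichZagier2001, §1.2 Conjecture 1] -/
theorem piWorld_mem_relations_of_eval_eq_zero_of_mem_closure {x : FormalRep}
    (hx : x ∈ AddSubgroup.closure
      ((({y : FormalRep | ∃ (k : ℕ) (S : Finset ℕ) (coef : ℕ → ℝ) (N : IntegralRep (2 * (k + 1))),
          (∀ i ∈ S, IsAlgebraic ℚ (coef i)) ∧ N.domain = {x | ∀ i, x i ∈ Set.Ioo (0:ℝ) 1} ∧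
          EqOn N.integrand (fun x => (∑ i ∈ S, coef i * (∏ l, x l) ^ i) / (1 - ∏ l, x l)) N.domain ∧
          y = of N} ∪
       {y : FormalRep | ∃ (w : ℕ) (c : ℝ) (N : IntegralRep w), IsAlgebraic ℚ c ∧
          N.domain = {x | ∀ i, x i ∈ Set.Ioo (0:ℝ) 1} ∧ EqOn N.integrand (fun _ => c) N.domain ∧ y = of N} ∪
       {y : FormalRep | ∃ (r : ℝ) (Z : IntegralRep 0), IsAlgebraic ℚ r ∧ Z.domain = Set.univ ∧
          (Z.integrand = fun _ => r) ∧ y = of Z} ∪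
       {y : FormalRep | ∃ (P : MvPolynomial (Fin 2) ℝ) (N : IntegralRep 2),
          (∀ s, IsAlgebraic ℚ (P.coeff s)) ∧ N.domain = {x | ∀ i, x i ∈ Set.Ioo (0:ℝ) 1} ∧
          EqOn N.integrand (fun x => MvPolynomial.eval x P / (1 - x 0 * x 1)) N.domain ∧ y = of N} ∪
       {y : FormalRep | ∃ (P : MvPolynomial (Fin 2) ℝ) (N : IntegralRep 2),
          (∀ s, IsAlgebraic ℚ (P.coeff s)) ∧ (∀ s ∈ P.support, Even (s 0 + s 1)) ∧
          N.domain = {x | ∀ i, x i ∈ Set.Ioo (0:ℝ) 1} ∧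
          EqOn N.integrand (fun x => MvPolynomial.eval x P / (1 - x 0 ^ 2 * x 1 ^ 2)) N.domain ∧
          y = of N} ∪
       {y : FormalRep | ∃ (k₁ k₂ j a b : ℕ) (c : ℝ) (N : IntegralRep 2), 0 < k₁ ∧ 0 < k₂ ∧ 0 < j ∧
          a + 1 = j * k₁ ∧ b + 1 = j * k₂ ∧ IsAlgebraic ℚ c ∧
          N.domain = {x | ∀ i, x i ∈ Set.Ioo (0:ℝ) 1} ∧
          EqOn N.integrand (fun x => c * (x 0 ^ a * x 1 ^ b) / (1 - x 0 ^ k₁ * x 1 ^ k₂)) N.domain ∧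
          y = of N} ∪
       {y : FormalRep | ∃ (k₁' k₂' j a b : ℕ) (c : ℝ) (N : IntegralRep 2), 0 < k₁' ∧ 0 < k₂' ∧
          a + 1 = (2 * j + 1) * k₁' ∧ b + 1 = (2 * j + 1) * k₂' ∧ IsAlgebraic ℚ c ∧
          N.domain = {x | ∀ i, x i ∈ Set.Ioo (0:ℝ) 1} ∧
          EqOn N.integrand (fun x => c * (x 0 ^ a * x 1 ^ b) / (1 - x 0 ^ (2 * k₁') * x 1 ^ (2 * k₂')))
            N.domain ∧ y = of N}) ∪
       ({y : FormalRep | ∃ (P : MvPolynomial (Fin 2) ℚ) (N : IntegralRep 2),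
          N.domain = {x | ∀ i, x i ∈ Set.Ioo (0:ℝ) 1} ∧
          EqOn N.integrand (fun x => (MvPolynomial.aeval x P : ℝ) / (1 - x 0 * x 1)) N.domain ∧
          y = of N} ∪
       {y : FormalRep | ∃ (m : ℕ) (p : MvPolynomial (Fin m) ℚ) (N : IntegralRep m),
          N.domain = {x | ∀ i, x i ∈ Set.Ioo (0:ℝ) 1} ∧
          EqOn N.integrand (fun x => (MvPolynomial.aeval x p : ℝ)) N.domain ∧ y = of N}) ∪
       {y : FormalRep | ∃ (c : ℚ) (n : ℕ) (a b a' b' : ℕ → ℕ) (R : IntegralRep 2),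
          (∀ t ∈ Set.Ioo (0:ℝ) 1,
            ∏ d ∈ Finset.range n, (∑ i ∈ Finset.range (d + 1), t ^ i) ^ (a' d) *
              (1 / (1 - t ^ (d + 1))) ^ (b' d) ≤
            ∏ d ∈ Finset.range n, (∑ i ∈ Finset.range (d + 1), t ^ i) ^ (a d) *
              (1 / (1 - t ^ (d + 1))) ^ (b d)) ∧
          R.domain = KZlog.band {y : Fin 1 → ℝ | 0 < y 0 ∧ y 0 < 1} (fun _ => (1:ℝ))
            (fun y => (∏ d ∈ Finset.range n,
              (∑ i ∈ Finset.range (d + 1), y 0 ^ i) ^ (a d) * (1 / (1 - y 0 ^ (d + 1))) ^ (b d)) /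
              (∏ d ∈ Finset.range n,
              (∑ i ∈ Finset.range (d + 1), y 0 ^ i) ^ (a' d) * (1 / (1 - y 0 ^ (d + 1))) ^ (b' d))) ∧
          EqOn R.integrand (fun z => ((c : ℝ) / z 0) / z 1) R.domain ∧ y = of R}) ∪
       {y : FormalRep | ∃ (A : ℝ → ℝ) (n : ℕ) (a b a' b' : ℕ → ℕ) (k : ℕ) (N : IntegralRep 2),
          IsSemialgebraicFunOn ℚ {y : Fin 1 → ℝ | 0 < y 0 ∧ y 0 < 1} (fun y => A (y 0)) ∧
          DifferentiableOn ℝ (fun y : Fin 1 → ℝ => A (y 0)) {y : Fin 1 → ℝ | 0 < y 0 ∧ y 0 < 1} ∧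
          (∀ x ∈ Set.Ioo (0:ℝ) 1, 0 < A x) ∧
          (∃ T : IntegralRep 2,
            T.domain = KZlog.band {y : Fin 1 → ℝ | 0 < y 0 ∧ y 0 < 1} (fun _ => (0:ℝ)) (fun _ => (1:ℝ)) ∧
            T.integrand = fun z => 1 / (A (z 0) + z 0 * z 1)) ∧
          (∀ t ∈ Set.Ioo (0:ℝ) 1, (A t + t) / A t =
            (∏ d ∈ Finset.range n, (∑ i ∈ Finset.range (d + 1), t ^ i) ^ (a d) *
              (1 / (1 - t ^ (d + 1))) ^ (b d)) /
            (∏ d ∈ Finset.range n, (∑ i ∈ Finset.range (d + 1), t ^ i) ^ (a' d) *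
              (1 / (1 - t ^ (d + 1))) ^ (b' d))) ∧
          N.domain = {x | ∀ i, x i ∈ Set.Ioo (0:ℝ) 1} ∧
          EqOn N.integrand (fun z => (k : ℝ) / (A (z 0) + z 0 * z 1)) N.domain ∧ y = of N}))
    (hv : eval x = 0) : x ∈ relations := by
  classical
  obtain ⟨Zf, hZf⟩ := exists_ptCarrierA
  obtain ⟨Bf, hBf⟩ := exists_zetaCarrier
  obtain ⟨hvalC, hvalB⟩ := value_kit
  obtain ⟨q, T, β, hq, hβ, h⟩ := piWorld_exists_nf_of_mem_closure Zf hZf Bf hBf hx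
  have hsub : x - (of (Zf q) + ∑ k ∈ T, of (Bf k (β k))) ∈ relations := by
    rw [← QuotientAddGroup.eq_iff_sub_mem, ← QuotientAddGroup.mk'_apply, ← QuotientAddGroup.mk'_apply, h,
      map_add, map_sum]
  have h0 := relations_le_ker_eval_holds hsub
  rw [AddMonoidHom.mem_ker, map_sub, hv, zero_sub, neg_eq_zero, map_add, map_sum, eval_of] at h0
  simp only [eval_of] at h0
  have hZv : (Zf q).value = q :=
    hvalC 0 q (Zf q) (by rw [(hZf q hq).1]; ext x; simp) (by rw [(hZf q hq).2]; exact fun _ _ => rfl)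
  have hBv : ∀ k ∈ T, (Bf k (β k)).value = β k * zetaValue (2 * (k + 1)) := fun k hk =>
    hvalB _ (β k) (Bf k (β k)) (by omega) (hBf k _ (hβ k hk)).1 fun x _ => by
      rw [(hBf k _ (hβ k hk)).2]; simp
  rw [hZv, Finset.sum_congr rfl hBv] at h0
  obtain ⟨rfl, hβ0⟩ := even_zeta_rigid T β q hβ hq h0
  have hcl : QuotientAddGroup.mk' relations x = 0 := by
    rw [h, ptCarrier_zero Zf hZf, zero_add]
    exact Finset.sum_eq_zero fun k hk => by rw [hβ0 k hk]; exact zetaCarrier_zero Bf hBf k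
  rwa [QuotientAddGroup.mk'_apply, QuotientAddGroup.eq_zero_iff] at hcl

/-- **Across the `ℚ̄[π²]` world**: an alternating box `[(0,1)², c/(1+xy)]`… is covered by part
`…LevelTwoEvenLayer`; here the genuinely new comparisons are ACROSS WEIGHTS, e.g. a weight-four
diagonal box against a weight-two level-one box — equal values force KZ-equivalence (by transcendence of
`π²` both values must then be algebraic, i.e. the `π⁴`- and `π²`-parts vanish separately, and the
calculus realises this). [cite: KontsevichZagier2001, §1.2 Conjecture 1] -/
theorem piWorld_evenZeta_equivalent_levelOne_of_value_eq (k : ℕ) (S : Finset ℕ) (coef : ℕ → ℝ)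
    (halg : ∀ i ∈ S, IsAlgebraic ℚ (coef i)) (P : MvPolynomial (Fin 2) ℝ)
    (hP : ∀ s, IsAlgebraic ℚ (P.coeff s)) (N : IntegralRep (2 * (k + 1))) (N' : IntegralRep 2)
    (hNd : N.domain = {x | ∀ i, x i ∈ Set.Ioo (0:ℝ) 1})
    (hNi : EqOn N.integrand (fun x => (∑ i ∈ S, coef i * (∏ l, x l) ^ i) / (1 - ∏ l, x l)) N.domain)
    (hN'd : N'.domain = {x | ∀ i, x i ∈ Set.Ioo (0:ℝ) 1})
    (hN'i : EqOn N'.integrand (fun x => MvPolynomial.eval x P / (1 - x 0 * x 1)) N'.domain)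
    (hv : N.value = N'.value) : Equivalent N N' := by
  refine piWorld_mem_relations_of_eval_eq_zero_of_mem_closure (AddSubgroup.sub_mem _
    (AddSubgroup.subset_closure (Or.inl (Or.inl (Or.inl (Or.inl (Or.inl (Or.inl (Or.inl (Or.inl (Or.inl ⟨k, S, coef, N, halg, hNd, hNi, rfl⟩))))))))))
    (AddSubgroup.subset_closure (Or.inl (Or.inl (Or.inl (Or.inl (Or.inl (Or.inl (Or.inr ⟨P, N', hP, hN'd, hN'i, rfl⟩))))))))) ?_
  rw [map_sub, eval_of, eval_of, hv, sub_self]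

end Summit.KontsevichZagierPeriods.HurwitzMicroSectors.NormalFormPrinciple.PiBox.EvenZeta
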